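import Literature.MathematicalPhysics.QuantumFieldTheory.Balaban1983to89.B9SectBStepUClosedSU
import Literature.MathematicalPhysics.QuantumFieldTheory.Balaban1983to89.B9Thm310DeltaAIsUnitOfRegYP335AtLettersY

/-!
# Balaban [B9], Thm 3.4 p. 400 / Sect. B at `G = SU(N)` — THE (α3) FACE WITH «`Δ_a(U)` INVERTIBLE ON THE CLASS» SUPPLIED: the composition of
# `B9SectBStepUClosedSU.sectBStepU_C37GY_su_extraYPb_of_isUnit` (this seat) with dag-n06-j's `hunitA_of_sections` (Thm 3.10 ⇒ Thm 3.3 at section-carrying members,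
# over lit-balaban's member assembler) — the Sect.-B step at the stage-3 record displays ONLY the sections `hι`, the neighbour threshold `hM₀B` and print's Thms 3.2 ∕ 3.3
# (pub-ymgap N06, seat dag-n06-c g18; count-neutral)

T. Bałaban, *Propagators for lattice gauge theories in a background field*, Commun. Math. Phys. **99** (1985) 389–434 [`Balaban1985BackgroundPropagators`, "B9"],
Thm 3.4 p. 400, Sect. B pp. 400–407, Thm 3.3 p. 399, Thm 3.10 (3.105)–(3.106) p. 414 («For M sufficiently large this implies G = G₀(I − R)⁻¹»), p. 416 («This implies
Theorem 3.3.»), (3.35) p. 396; [4] = T. Bałaban, *Propagators and renormalization transformations for lattice gauge theories. II*, Commun. Math. Phys. **96** (1984)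
223–250 [`Balaban1984PropagatorsII`], Lemma 2.1 (2.59)–(2.61) pp. 233–234.

statement-level skeleton of published theorems with citation tags; proofs where landed; nothing here is a claim about the Yang–Mills mass gap

WHY THIS FILE (cell context).  `B9SectBStepUClosedSU` reduced the (α3) face at `SU(N)` to the displays `hι hA hb₁ hM₀B h32 h33`, `hA` being the ∃-threshold form of
«`Δ_a(U)` is a unit for every (3.35)-regular `U` above the thresholds».  dag-n06-j g31's `B9Thm310DeltaAIsUnitOfRegYP335AtLettersY.hunitA_of_sections` (p732167) proves
exactly that form at the stage-3 record `θ` for every SECTION-CARRYING sub-family — and the (α3) face quantifies its sub-family `f` together with sections `ιB, hι` — from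
lit-balaban's member assembler `B9Thm310DeltaAAtMemberOfCubeData.deltaA_at_member_of_cubeData` (Thm 3.10 ⇒ Thm 3.3).  This file is the one-line composition; `hb₁` is
the record's `θ.hb`.

WHAT IS PROVED (sorry-free; standard axioms; 0 `def`; nothing of [B9] asserted).
* ★★★ `sectBStepU_C37GY_su_extraYPb_closed` ∕ ★★ `thm34U_C37GY_su_extraYPb_closed` — at `θ : Stage3Params`, `M⋆`, `N ≥ 1`: `SectBStepU` ∕ `Thm34U` over the coded
  carrier at `(extraYPb, SU(N), c35Y)` for a sub-family `f` with sections `ιB hι`, DISPLAYING ONLY `hι`, `hM₀B : nbrM₀Y … (2(d+1)) ≤ M⋆`, `h32`, `h33` (+ data `b ιB C38`).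

HONEST SCOPE.  Composition of landed theorems; `h32 h33` (print's Theorems 3.2 ∕ 3.3 on the class, read along the decoding) REMAIN displayed; inner-corner members (no
section) are outside the sub-families by the face's own `hι`; NOT a node discharge; COUNT-NEUTRAL; N06 NOT discharged; nothing continuum ∕ ℝ⁴ ∕ OS ∕ mass gap ∕ Clay.
Cell `pub-ymgap` (HUMAN RULING D-0062), Track A node N06 [B9], seat `pub-ymgap-dag-n06-c` g18, 2026-08-29.  NEW file; nothing landed is modified.  Net new unproved facts: 0.
-/

noncomputable section

namespace Literature.MathematicalPhysics.QuantumFieldTheory.Balaban1983to89.B9SectBStepUClosedSUOfSections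

open scoped Matrix.Norms.L2Operator
open B6Ineq2142KLevelV1 (β)
open B9PinMembersKLevelV1 (MemberY geo9Y)
open B9PinGeometryKLevelV1 (c35Y)
open B9Eq360DeltaPrimeAY (AfldY)
open B7Prop2SpecialUnitary (specialUnitaryUnits)
open B9SectBCodedClassR (bg9YC extraYPb)
open B9SectBCodedReadingsUR (SectBStepU Thm34U)
open B9SectBKerFrameCodedYR (CinvY)
open B9SectBCodedClassGY (C37GY)
open B9GeoNbrCountKLevelV1 (nbrM₀Y)
open B9SectBStepUClosedSU (sectBStepU_C37GY_su_extraYPb_of_isUnit thm34U_C37GY_su_extraYPb_of_isUnit)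
open B9Thm310DeltaAIsUnitOfRegYP335AtLettersY (hunitA_of_sections)
open Node00 (Stage3Params BlkY IBondY CfgY GAY GpY parSymY parBY kernelFamilyS kernelFamilyB)

variable {N : ℕ} (θ : Stage3Params) (Mstar : ℕ)
variable {J : Type} (f : J → MemberY θ.d₆ θ.ℓ₆ θ.hd' θ.hL' θ.b₀ θ.b₁ Mstar) [∀ x : MemberY θ.d₆ θ.ℓ₆ θ.hd' θ.hL' θ.b₀ θ.b₁ Mstar, Fintype (geo9Y x).Site]
  [instDS : ∀ x : MemberY θ.d₆ θ.ℓ₆ θ.hd' θ.hL' θ.b₀ θ.b₁ Mstar, DecidableEq (geo9Y x).Site]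
  [instNE : ∀ x : MemberY θ.d₆ θ.ℓ₆ θ.hd' θ.hL' θ.b₀ θ.b₁ Mstar, Nonempty (geo9Y x).Site]
  {ι : Type} [Fintype ι] [DecidableEq ι] (b : Module.Basis ι ℝ (Matrix (Fin N) (Fin N) ℂ))
  (ιB : ∀ j : J, BlkY (f j).toKIdx → IBondY (f j).toKIdx)
  (C38 : ∀ j : J, ℝ → CfgY (Matrix (Fin N) (Fin N) ℂ) (f j).toKIdx → AfldY (Matrix (Fin N) (Fin N) ℂ) (f j).toKIdx → Prop)

/-- ★★★ **THE (α3) FACE AT THE STAGE-3 RECORD, `SU(N)`, DISPLAYING ONLY THE SECTIONS, THE NEIGHBOUR THRESHOLD AND THMS 3.2 ∕ 3.3**: `SectBStepU` over the coded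
carrier at `(extraYPb, SU(N), c35Y)` — `B9SectBStepUClosedSU.sectBStepU_C37GY_su_extraYPb_of_isUnit` with `hA` SUPPLIED by dag-n06-j's `hunitA_of_sections θ M⋆ hN`
(at the face's own `f ιB hι`) and `hb₁ := θ.hb`. [cite: Balaban1985BackgroundPropagators, Thm 3.4 p.400, Sect. B pp.400–407, Thm 3.3 p.399, (3.106) p.414, p.416, (3.35) p.396; Balaban1984PropagatorsII, Lemma 2.1 (2.59)–(2.61) pp.233–234] -/
theorem sectBStepU_C37GY_su_extraYPb_closed [NormOneClass (Matrix (Fin N) (Fin N) ℂ)] [FiniteDimensional ℝ (Matrix (Fin N) (Fin N) ℂ)] (hN : 1 ≤ N)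
    (hι : ∀ (j : J) (s : BlkY (f j).toKIdx), β (f j).toKIdx.hN (f j).toKIdx.D (f j).toKIdx.hk (ιB j s) = s)
    (hM₀B : nbrM₀Y θ.d₆ θ.ℓ₆ θ.hd' θ.hL' θ.b₀ θ.b₁ (2 * ((θ.d₆ : ℝ) + 1)) ≤ Mstar)
    (h32 : B9.Thm32Printed (θ.d₆ + 1) c35Y (fun j => geo9Y (f j))
      (fun j => bg9YC (Matrix (Fin N) (Fin N) ℂ) (specialUnitaryUnits (Fin N)) (extraYPb (Matrix (Fin N) (Fin N) ℂ) (specialUnitaryUnits (Fin N))) (f j))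
      (CinvY (extraYPb (Matrix (Fin N) (Fin N) ℂ) (specialUnitaryUnits (Fin N))) f (specialUnitaryUnits (Fin N)) (fun j => parSymY (f j).toKIdx)))
    (h33 : B9.Thm33Printed c35Y (fun j => geo9Y (f j))
      (fun j => bg9YC (Matrix (Fin N) (Fin N) ℂ) (specialUnitaryUnits (Fin N)) (extraYPb (Matrix (Fin N) (Fin N) ℂ) (specialUnitaryUnits (Fin N))) (f j))
      (fun j => kernelFamilyS (f j).toKIdx (bg9YC (Matrix (Fin N) (Fin N) ℂ) (specialUnitaryUnits (Fin N)) (extraYPb (Matrix (Fin N) (Fin N) ℂ) (specialUnitaryUnits (Fin N))) (f j))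
        (fun U => U) (GpY (f j).toKIdx (parSymY (f j).toKIdx)) (parSymY (f j).toKIdx))
      (fun j => kernelFamilyB (f j).toKIdx (bg9YC (Matrix (Fin N) (Fin N) ℂ) (specialUnitaryUnits (Fin N)) (extraYPb (Matrix (Fin N) (Fin N) ℂ) (specialUnitaryUnits (Fin N))) (f j))
        (fun U => U) (GAY (f j).toKIdx (parSymY (f j).toKIdx) (parBY (f j).toKIdx) (GpY (f j).toKIdx (parSymY (f j).toKIdx))) (parBY (f j).toKIdx))) :
    SectBStepU (extraYPb (Matrix (Fin N) (Fin N) ℂ) (specialUnitaryUnits (Fin N))) f (θ.d₆ + 1) c35Y (specialUnitaryUnits (Fin N)) b (fun j => parSymY (f j).toKIdx)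
      (fun j => GAY (f j).toKIdx (parSymY (f j).toKIdx) (parBY (f j).toKIdx) (GpY (f j).toKIdx (parSymY (f j).toKIdx))) (fun j => parBY (f j).toKIdx)
      (fun j => C37GY (specialUnitaryUnits (Fin N)) (f j) (ιB j) (4 * ((θ.d₆ : ℝ) + 1) * Real.exp (3 * (((θ.d₆ : ℝ) + 1) / 2)))) C38
      (CinvY (extraYPb (Matrix (Fin N) (Fin N) ℂ) (specialUnitaryUnits (Fin N))) f (specialUnitaryUnits (Fin N)) (fun j => parSymY (f j).toKIdx)) := by
  haveI : Nonempty (Fin N) := ⟨⟨0, hN⟩⟩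
  obtain ⟨MInv₀, aInv, hMInv₀, haInv, H⟩ := hunitA_of_sections θ Mstar hN
  exact sectBStepU_C37GY_su_extraYPb_of_isUnit f b ιB C38 hι ⟨MInv₀, aInv, hMInv₀, haInv, fun MInv hMI j α₀ U => H MInv hMI f ιB hι j α₀ U⟩
    ((le_of_lt θ.hb.1).trans θ.hb.2) hM₀B h32 h33

/-- ★★ Theorem 3.4 in U-letters at the stage-3 record, `SU(N)`, same displays (over `thm34U_C37GY_su_extraYPb_of_isUnit`).
[cite: Balaban1985BackgroundPropagators, Thm 3.4 p.400, Thm 3.3 p.399, p.416; Balaban1984PropagatorsII, Lemma 2.1 p.234] -/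
theorem thm34U_C37GY_su_extraYPb_closed [NormOneClass (Matrix (Fin N) (Fin N) ℂ)] [FiniteDimensional ℝ (Matrix (Fin N) (Fin N) ℂ)] (hN : 1 ≤ N)
    (hι : ∀ (j : J) (s : BlkY (f j).toKIdx), β (f j).toKIdx.hN (f j).toKIdx.D (f j).toKIdx.hk (ιB j s) = s)
    (hM₀B : nbrM₀Y θ.d₆ θ.ℓ₆ θ.hd' θ.hL' θ.b₀ θ.b₁ (2 * ((θ.d₆ : ℝ) + 1)) ≤ Mstar)
    (h32 : B9.Thm32Printed (θ.d₆ + 1) c35Y (fun j => geo9Y (f j))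
      (fun j => bg9YC (Matrix (Fin N) (Fin N) ℂ) (specialUnitaryUnits (Fin N)) (extraYPb (Matrix (Fin N) (Fin N) ℂ) (specialUnitaryUnits (Fin N))) (f j))
      (CinvY (extraYPb (Matrix (Fin N) (Fin N) ℂ) (specialUnitaryUnits (Fin N))) f (specialUnitaryUnits (Fin N)) (fun j => parSymY (f j).toKIdx)))
    (h33 : B9.Thm33Printed c35Y (fun j => geo9Y (f j))
      (fun j => bg9YC (Matrix (Fin N) (Fin N) ℂ) (specialUnitaryUnits (Fin N)) (extraYPb (Matrix (Fin N) (Fin N) ℂ) (specialUnitaryUnits (Fin N))) (f j))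
      (fun j => kernelFamilyS (f j).toKIdx (bg9YC (Matrix (Fin N) (Fin N) ℂ) (specialUnitaryUnits (Fin N)) (extraYPb (Matrix (Fin N) (Fin N) ℂ) (specialUnitaryUnits (Fin N))) (f j))
        (fun U => U) (GpY (f j).toKIdx (parSymY (f j).toKIdx)) (parSymY (f j).toKIdx))
      (fun j => kernelFamilyB (f j).toKIdx (bg9YC (Matrix (Fin N) (Fin N) ℂ) (specialUnitaryUnits (Fin N)) (extraYPb (Matrix (Fin N) (Fin N) ℂ) (specialUnitaryUnits (Fin N))) (f j))
        (fun U => U) (GAY (f j).toKIdx (parSymY (f j).toKIdx) (parBY (f j).toKIdx) (GpY (f j).toKIdx (parSymY (f j).toKIdx))) (parBY (f j).toKIdx))) :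
    Thm34U (extraYPb (Matrix (Fin N) (Fin N) ℂ) (specialUnitaryUnits (Fin N))) f c35Y (specialUnitaryUnits (Fin N)) b (fun j => parSymY (f j).toKIdx)
      (fun j => GAY (f j).toKIdx (parSymY (f j).toKIdx) (parBY (f j).toKIdx) (GpY (f j).toKIdx (parSymY (f j).toKIdx))) (fun j => parBY (f j).toKIdx)
      (fun j => C37GY (specialUnitaryUnits (Fin N)) (f j) (ιB j) (4 * ((θ.d₆ : ℝ) + 1) * Real.exp (3 * (((θ.d₆ : ℝ) + 1) / 2)))) C38 := by
  haveI : Nonempty (Fin N) := ⟨⟨0, hN⟩⟩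
  obtain ⟨MInv₀, aInv, hMInv₀, haInv, H⟩ := hunitA_of_sections θ Mstar hN
  exact thm34U_C37GY_su_extraYPb_of_isUnit f b ιB C38 hι ⟨MInv₀, aInv, hMInv₀, haInv, fun MInv hMI j α₀ U => H MInv hMI f ιB hι j α₀ U⟩
    ((le_of_lt θ.hb.1).trans θ.hb.2) hM₀B h32 h33

end Literature.MathematicalPhysics.QuantumFieldTheory.Balaban1983to89.B9SectBStepUClosedSUOfSections

end
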